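import Summits.SmoothPoincare4.SmoothPoincare4.Theses.CongruenceShadows
import Literature.Topology.FourManifolds.SPC4HandlesTwoHandlebodyGenusCount

/-!
# `AgkCor6Sufficiency` — negative-side support VIII: "filling uniqueness" is Laudenbach–Poénaru restated

Companion of `KernelNecessity.lean` (crux item `stmt-SmoothPoincare4-10894`, work file
`Cruxes/AgkCor6Sufficiency/Disproof.lean` §12, cycle 3).  The crux line
`lp-by-sphere-system-surgery` takes as its lever the statement "FillingUniqueness" (Meier–Scott
2025, Thm. 4.1(2) with `G = 1`, Prop. 4.8): every diffeomorphism between the boundaries of two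
compact connected orientable smooth `4`-dimensional `1`-handlebodies extends to a diffeomorphism
of the handlebodies.  Recorded here, kernel-checked and with the lever INLINED (no `Prop`
constant): that statement is EQUIVALENT to the tree's Laudenbach–Poénaru fact
`Literature.Topology.FourManifolds.exists_diffeomorph_comp_incl_eq` (universe `0`) —
`(⇒)` by `V' := V`; `(⇐)` through the tree's PROVED classification of compact connected
orientable `1`-handlebodies by their boundary
(`nonempty_diffeomorph_of_isHandlebodyOfIndexLE_one_of_boundary_homeomorph`: NORM, the genus
count and UNIQ₄, all discharged) and boundary transport (`BoundaryData.restrictDiffeomorph`),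
exactly as in Matsumoto's proof of Lemma 5.20.  So the line proposes a new PROOF of LP (sphere
systems instead of Laudenbach 1973), not an easier STATEMENT; triage's "why easier" must be read
about the proof route.  Nothing here concludes a Theses statement.

References: F. Laudenbach, V. Poénaru, *A note on 4-dimensional handlebodies*, Bull. SMF 100
(1972) 337–344; Y. Matsumoto, *An introduction to Morse theory* (2001), §5.3, Lemma 5.20;
J. Meier, A. Scott (2025), arXiv:2501.10524, Thm. 4.1 and Prop. 4.8.
-/

noncomputable section

namespace Summit.SmoothPoincare4.SmoothPoincare4.Theorems.AgkCor6Sufficiency.Negative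

open Set Function Literature.Topology.FourManifolds
open scoped Manifold ContDiff Topology

/-- **Laudenbach–Poénaru gives filling uniqueness**: granted
`exists_diffeomorph_comp_incl_eq.{0}`, every diffeomorphism `ψ : ∂V ≅ ∂V'` between the boundary
data of two compact connected orientable smooth `4`-dimensional `1`-handlebodies extends to
`Ψ : V ≅ V'` with `Ψ ∘ incl = incl' ∘ ψ` (pick any `Ψ₀ : V ≅ V'` by the boundary classification,
extend `ψ ≫ (∂Ψ₀)⁻¹` over `V` by LP, compose). [cite: Matsumoto2001, §5.3, proof of Lemma 5.20] [cite: LaudenbachPoenaruBSMF1972, main theorem] -/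
theorem fillingUniqueness_of_laudenbachPoenaru (hLP : exists_diffeomorph_comp_incl_eq.{0})
    (V V' : Type) [TopologicalSpace V] [T2Space V] [SecondCountableTopology V] [CompactSpace V]
    [ConnectedSpace V] [ChartedSpace (EuclideanHalfSpace 4) V] [IsManifold (𝓡∂ 4) ∞ V]
    [TopologicalSpace V'] [T2Space V'] [SecondCountableTopology V'] [CompactSpace V']
    [ConnectedSpace V'] [ChartedSpace (EuclideanHalfSpace 4) V'] [IsManifold (𝓡∂ 4) ∞ V']
    (hV : IsHandlebodyOfIndexLE 3 1 V) (hV' : IsHandlebodyOfIndexLE 3 1 V')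
    (ho : IsOrientable (𝓡∂ 4) V) (ho' : IsOrientable (𝓡∂ 4) V')
    (b : BoundaryData (𝓡∂ 4) V (𝓡 3)) (b' : BoundaryData (𝓡∂ 4) V' (𝓡 3))
    (ψ : b.carrier ≃ₘ⟮𝓡 3, 𝓡 3⟯ b'.carrier) :
    ∃ Ψ : V ≃ₘ⟮𝓡∂ 4, 𝓡∂ 4⟯ V', ⇑Ψ ∘ b.incl = b'.incl ∘ ⇑ψ := by
  obtain ⟨Ψ₀⟩ := nonempty_diffeomorph_of_isHandlebodyOfIndexLE_one_of_boundary_homeomorph V V'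
    hV hV' ho ho' b b' ψ.toHomeomorph
  obtain ⟨Φ, hΦ⟩ := hLP V hV ho b (ψ.trans (b.restrictDiffeomorph b' Ψ₀).symm)
  refine ⟨Φ.trans Ψ₀, funext fun z => ?_⟩
  have h1 : Φ (b.incl z) = b.incl ((ψ.trans (b.restrictDiffeomorph b' Ψ₀).symm) z) :=
    congrFun hΦ z
  rw [Diffeomorph.coe_trans, comp_apply, comp_apply, h1,
    ← BoundaryData.incl_restrictDiffeomorph (b₂ := b') Ψ₀]
  simp only [Diffeomorph.coe_trans, comp_apply, Diffeomorph.apply_symm_apply]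

/-- **Filling uniqueness (the lever of line `lp-by-sphere-system-surgery`, inlined) is equivalent
to the tree's Laudenbach–Poénaru fact** at universe `0`. [cite: LaudenbachPoenaruBSMF1972, main theorem] [cite: Matsumoto2001, §5.3, proof of Lemma 5.20] -/
theorem fillingUniqueness_iff_laudenbachPoenaru :
    (∀ (V V' : Type) [TopologicalSpace V] [T2Space V] [SecondCountableTopology V] [CompactSpace V]
      [ConnectedSpace V] [ChartedSpace (EuclideanHalfSpace 4) V] [IsManifold (𝓡∂ 4) ∞ V]
      [TopologicalSpace V'] [T2Space V'] [SecondCountableTopology V'] [CompactSpace V']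
      [ConnectedSpace V'] [ChartedSpace (EuclideanHalfSpace 4) V'] [IsManifold (𝓡∂ 4) ∞ V']
      (_ : IsHandlebodyOfIndexLE 3 1 V) (_ : IsHandlebodyOfIndexLE 3 1 V')
      (_ : IsOrientable (𝓡∂ 4) V) (_ : IsOrientable (𝓡∂ 4) V')
      (b : BoundaryData (𝓡∂ 4) V (𝓡 3)) (b' : BoundaryData (𝓡∂ 4) V' (𝓡 3))
      (ψ : b.carrier ≃ₘ⟮𝓡 3, 𝓡 3⟯ b'.carrier),
      ∃ Ψ : V ≃ₘ⟮𝓡∂ 4, 𝓡∂ 4⟯ V', ⇑Ψ ∘ b.incl = b'.incl ∘ ⇑ψ) ↔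
    exists_diffeomorph_comp_incl_eq.{0} :=
  ⟨fun h V _ _ _ _ _ _ _ hV ho b φ => h V V hV hV ho ho b b φ,
    fun hLP V V' _ _ _ _ _ _ _ _ _ _ _ _ _ _ hV hV' ho ho' b b' ψ =>
      fillingUniqueness_of_laudenbachPoenaru hLP V V' hV hV' ho ho' b b' ψ⟩

end Summit.SmoothPoincare4.SmoothPoincare4.Theorems.AgkCor6Sufficiency.Negative
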